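import Literature.GroupTheory.Nilpotent.PolynomialGrowthNilpotent
import Literature.GroupTheory.Nilpotent.GrowthFiniteIndexTransfer
import Mathlib.GroupTheory.Schreier
import HarnessLib

/-!
# Polynomial growth of finitely generated nilpotent groups (Wolf 1968), III: the Cayley-graph form, and
# virtually nilpotent groups

J. A. Wolf, J. Differential Geometry 2 (1968) 421–446, **Theorem 3.2 (upper bound): every Cayley graph
`Cay(N; T)` (`T` finite) of a NILPOTENT group has polynomial growth, `|B(g,n)| ≤ C·(n+1)^D`**; and — through
Schreier's lemma (Mathlib) and the finite-index transfer OF RECORD `exists_polynomialGrowth_of_finiteIndex`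
(«GrowthFiniteIndexTransfer», Woess 2000 Lemma 3.14) — the same for every Cayley graph of a finitely generated
group with a nilpotent subgroup of finite index (RULING W-1 shape (a): ONE public transfer theorem in the tree;
this file only composes with it).

* §1 balls of `SimpleGraph.mulCayley ↑T` consist of values `g · w` of words `w` of length `≤ n` in `T ∪ T⁻¹`
  (letters indexed by `T ⊕ T`), so `|B(g,n)|` is at most the word-ball count of file II;
* §2 Wolf's theorem for nilpotent groups in the `ballVolume (mulCayley ↑T)` currency (natural and real-exponent forms);
* §3 virtually nilpotent: `exists_ballVolume_mulCayley_le_rpow (S) (hS) (N) [N.FiniteIndex] [Group.IsNilpotent N]`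
  — LITERALLY the growth hypothesis `∃ C D : ℝ, ∀ g n, |B(g,n)| ≤ C·(n+1)^D` consumed under
  `Summits/CriticalPhenomena/…/Transplant/AutCylinder*`.

Topic `Literature/GroupTheory/Nilpotent`, namespace `Literature.GroupTheory.Nilpotent`; theorems only; the graph
vocabulary (`graphBall`, `ballVolume`) is the tree's (`Literature.Barriers.CriticalPhenomena`).  Lane `prim-bschramm`,
seat p3 (class C2).
-/

namespace Literature.GroupTheory.Nilpotent

open SimpleGraph Literature.Barriers.CriticalPhenomena

variable {Γ : Type*} [Group Γ]

/-! ## §1 Balls of a Cayley graph are word balls -/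

/-- **A vertex of `B(g,n)` in `Cay(Γ;T)` is `g · w` for a word `w` of length `≤ n` in `T ∪ T⁻¹`** (letters
indexed by `T ⊕ T`: `inl t ↦ t`, `inr t ↦ t⁻¹`). [cite: WolfGrowth1968, §3 (growth function)] -/
theorem exists_word_of_mem_graphBall (T : Finset Γ) {g h : Γ} {n : ℕ}
    (hh : h ∈ graphBall (mulCayley (↑T : Set Γ)) g n) :
    ∃ w : List (T ⊕ T), w.length ≤ n ∧
      h = g * (w.map (Sum.elim (fun s : T => (s : Γ)) (fun s : T => (s : Γ)⁻¹))).prod := by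
  obtain ⟨p, hp⟩ := hh
  induction p generalizing n with
  | nil => exact ⟨[], by simp, by simp⟩
  | @cons u v w hadj p ih =>
    have hlen : p.length ≤ n - 1 := by rw [Walk.length_cons] at hp; omega
    obtain ⟨l, hl, hw⟩ := ih hlen
    rw [mulCayley_adj] at hadj
    obtain ⟨-, hs | hs⟩ := hadj
    · refine ⟨Sum.inl ⟨u⁻¹ * v, hs⟩ :: l, ?_, ?_⟩
      · rw [List.length_cons, Walk.length_cons] at *; omega
      · rw [hw, List.map_cons, List.prod_cons, Sum.elim_inl, ← mul_assoc, mul_inv_cancel_left]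
    · refine ⟨Sum.inr ⟨v⁻¹ * u, hs⟩ :: l, ?_, ?_⟩
      · rw [List.length_cons, Walk.length_cons] at *; omega
      · rw [hw, List.map_cons, List.prod_cons, Sum.elim_inr, mul_inv_rev, inv_inv, ← mul_assoc, mul_inv_cancel_left]

/-- Hence `B(g,n) ⊆ g · (word ball of radius n)` and `|B(g,n)| ≤ |word ball|`. [cite: WolfGrowth1968, §3 (growth function)] -/
theorem ballVolume_mulCayley_le_ncard_wordBall (T : Finset Γ) (g : Γ) (n : ℕ) :
    ballVolume (mulCayley (↑T : Set Γ)) g n ≤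
      {x : Γ | ∃ w : List (T ⊕ T), w.length ≤ n ∧
        (w.map (Sum.elim (fun s : T => (s : Γ)) (fun s : T => (s : Γ)⁻¹))).prod = x}.ncard := by
  rw [ballVolume]
  have hsub : graphBall (mulCayley (↑T : Set Γ)) g n ⊆ (fun x => g * x) ''
      {x : Γ | ∃ w : List (T ⊕ T), w.length ≤ n ∧
        (w.map (Sum.elim (fun s : T => (s : Γ)) (fun s : T => (s : Γ)⁻¹))).prod = x} := by
    intro h hh
    obtain ⟨w, hw, rfl⟩ := exists_word_of_mem_graphBall T hh
    exact ⟨_, ⟨w, hw, rfl⟩, rfl⟩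
  refine (Set.ncard_le_ncard hsub ((wordBall_finite _ n).image _)).trans ?_
  exact Set.ncard_image_le (wordBall_finite _ n)

/-! ## §2 Wolf's theorem: polynomial growth of the Cayley graphs of a nilpotent group -/

/-- **Wolf's theorem (Cayley-graph form, nilpotent groups): every Cayley graph `Cay(N; T)`, `T` finite, of a
NILPOTENT group has polynomial growth** — `|B(g,n)| ≤ C·(n+1)^D` for all vertices `g` and radii `n`, with natural
constants `C ≥ 1`, `D` (file II's word-ball bound for `⊤ ≤ N`, `γ_c(N) = ⊥`, through §1; `T` need not generate).
[cite: WolfGrowth1968, Thm. 3.2] -/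
theorem ballVolume_mulCayley_le_polynomial_of_isNilpotent {N : Type*} [Group N] [hN : Group.IsNilpotent N]
    (T : Finset N) :
    ∃ C D : ℕ, 1 ≤ C ∧ ∀ (g : N) (n : ℕ), ballVolume (mulCayley (↑T : Set N)) g n ≤ C * (n + 1) ^ D := by
  obtain ⟨c, hc⟩ := (Subgroup.isNilpotent_iff_lowerCentralSeries (⊤ : Subgroup N)).1 (Group.isNilpotent_top.2 hN)
  obtain ⟨C, D, hC, h⟩ := ncard_wordBall_le_polynomial' (⊤ : Subgroup N) hc
    (Sum.elim (fun s : T => (s : N)) (fun s : T => (s : N)⁻¹)) (fun _ => Subgroup.mem_top _)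
  exact ⟨C, D, hC, fun g n => (ballVolume_mulCayley_le_ncard_wordBall T g n).trans (h n)⟩

/-- **… real-exponent form at the base point** (the input shape of the finite-index transfer of record
`exists_polynomialGrowth_of_finiteIndex`). [cite: WolfGrowth1968, Thm. 3.2] -/
theorem exists_ballVolume_mulCayley_le_rpow_of_isNilpotent {N : Type*} [Group N] [Group.IsNilpotent N]
    (T : Finset N) :
    ∃ C D : ℝ, ∀ n : ℕ, (ballVolume (mulCayley (↑T : Set N)) 1 n : ℝ) ≤ C * ((n : ℝ) + 1) ^ D := by
  obtain ⟨C, D, -, h⟩ := ballVolume_mulCayley_le_polynomial_of_isNilpotent T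
  refine ⟨C, D, fun n => ?_⟩
  rw [Real.rpow_natCast]
  exact_mod_cast h 1 n

/-! ## §3 Virtually nilpotent groups -/

/-- **Wolf's theorem for finitely generated VIRTUALLY NILPOTENT groups (Cayley-graph form)**: if `Γ` is finitely
generated and `N ≤ Γ` is a nilpotent subgroup of finite index, then every Cayley graph `Cay(Γ; S)`, `S` finite, has
`|B(g,n)| ≤ C·(n+1)^D` (real exponent).  Schreier's lemma (Mathlib: `N` is finitely generated) + §2 for `N` + the
finite-index transfer of record `exists_polynomialGrowth_of_finiteIndex` («GrowthFiniteIndexTransfer»).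
[cite: WolfGrowth1968, Thm. 3.2; §3 (finite index)] -/
theorem exists_ballVolume_mulCayley_le_rpow_of_fg [Group.FG Γ] (S : Finset Γ) (N : Subgroup Γ) [N.FiniteIndex]
    [Group.IsNilpotent N] :
    ∃ C D : ℝ, ∀ (g : Γ) (n : ℕ), (ballVolume (mulCayley (↑S : Set Γ)) g n : ℝ) ≤ C * ((n : ℝ) + 1) ^ D := by
  obtain ⟨T, hT⟩ := Group.fg_def.1 (inferInstance : Group.FG N)
  exact exists_polynomialGrowth_of_finiteIndex S N T hT (exists_ballVolume_mulCayley_le_rpow_of_isNilpotent T)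

/-- **… with the finite generation supplied by a finite generating set `S` of `Γ`** — LITERALLY the growth
hypothesis `∃ C D : ℝ, ∀ g n, (ballVolume (mulCayley ↑S) g n : ℝ) ≤ C·((n:ℝ)+1)^D` of the percolation corollaries
for virtually nilpotent Cayley graphs. [cite: WolfGrowth1968, Thm. 3.2; §3 (finite index)] -/
theorem exists_ballVolume_mulCayley_le_rpow (S : Finset Γ) (hS : Subgroup.closure (↑S : Set Γ) = ⊤)
    (N : Subgroup Γ) [N.FiniteIndex] [Group.IsNilpotent N] :
    ∃ C D : ℝ, ∀ (g : Γ) (n : ℕ), (ballVolume (mulCayley (↑S : Set Γ)) g n : ℝ) ≤ C * ((n : ℝ) + 1) ^ D := by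
  haveI : Group.FG Γ := ⟨⟨S, hS⟩⟩
  exact exists_ballVolume_mulCayley_le_rpow_of_fg S N

end Literature.GroupTheory.Nilpotent
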